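import Summits.BirchSwinnertonDyer.Rank1Residual.O5.NonSplitAtThreeLocal
import Summits.BirchSwinnertonDyer.Rank1Residual.O5.O5CompanionTransport
import Summits.BirchSwinnertonDyer.Rank1Residual.Additive.KodairaDictionaryThree
import Literature.NumberTheory.EllipticCurves.OggFormulaTypeIIIProofs
import Literature.NumberTheory.EllipticCurves.NeronLocalHeightCompletion
import Mathlib.NumberTheory.Padics.HeightOneSpectrum
import HarnessLib

/-!
# `O5.NonSplitAtThreeLaw` IS A THEOREM: on the tame potentially supersingular cell (t′) at `3`
# (Kodaira III / III*) the `3`-division polynomial has AT MOST ONE root in `ℚ₃` — `W[3]|G_{ℚ₃}` is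
# never split — UNCONDITIONALLY, from Tate's Step-4 / Step-9 normal forms and the valued-field algebra
# of `O5/NonSplitAtThreeLocal.lean`
# (cell `b2b-bsdres`; seat `b2b-bsdres-x11b3-p7` GEN 8 as CROSS-CELL POOL HAND — cc-typer-5 / o5-r1's
#  THEOREM-CANDIDATE G3-1′ `NonSplitAtThreeLaw` of `O5/O5CompanionTransport.lean`, "tag kept until a
#  kernel proof"; theorems only)

HONEST FRAMING (cell `b2b-bsdres`, run/shared/lean/b2b/bsd-rank1-residual/, verbatim in every file): the
goal of the cell is to DELETE the COMBINATION-SHAPED residual classes of the Birch–Swinnerton-Dyer formula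
for ALL analytic-rank `≤ 1` elliptic curves over `ℚ` — "full BSD formula for every rank `≤ 1` curve in
class `C`" assembled STRICTLY from published theorems — so that the rank-`≤ 1` remainder becomes exactly
the CONSTRUCTION-SHAPED classes, which are TYPED (missing-input `Prop`s), NOT attempted. This is not
"finishing BSD". Lane CLASS-CLOSURE / teams o5–o6 (O5 OPEN): research routes; census output is
EVIDENCE, never a Literature fact; nothing is booked; no mark of `RESIDUAL-MAP.md` moves. This file:
THEOREMS ONLY (no definition, no named fact, no `@[conjecture]` node, no `sorry`; net named-fact debt
`0`). NO hypothesis beyond the TARGET's own binders.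

## What is proved

* **`nonSplitAtThreeLaw_holds : NonSplitAtThreeLaw`** — the typed THEOREM-CANDIDATE, binders verbatim:
  for every elliptic, globally minimal `W/ℚ` with `ClassO5 W 3` and `SubTprime W 3`,
  `numStableLinesAtThree W ≤ 1` (at most one `G_{ℚ₃}`-stable line in `W[3]`, i.e. at most one root of
  `Ψ₃` in `ℚ₃`); via the class-free
* **`numStableLinesAtThree_le_one_of_kodairaSymbolAt_III_or_IIIstar`**: Kodaira `III` or `III*` at `3`
  ⟹ `numStableLinesAtThree W ≤ 1`; via
* `Ψ₃_root_unique_adicCompletion_of_kodairaSymbolAt_III_or_IIIstar` (the same over the completion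
  `ℚ_{(3)} = (placeOf 3).adicCompletion ℚ`), `NonSplitAtThree.Ψ₃_root_unique_of_shapeIII` /
  `…_of_shapeIIIstar` (any Dedekind `A`, place `v`, uniformiser `π` with `π = 3` in `K_v`: on a
  `K_v`-model with Tate's III resp. III* shapes of `b₂, b₄, b₆, Δ`, any two `K_v`-roots of `Ψ₃`
  coincide — III* by the weight rescaling `bᵢ ↦ bᵢ/π^{i/2}`, `x ↦ x/π` onto the III shape).

ROUTE (elementary; NOT the formal-group / Newton-polygon-of-`[3]` sketch of the target's docstring):
Tate's Step-4 / Step-9 normal forms over `K_v` (`exists_variableChange_b_of_kodairaSymbolAt_eq_III` /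
`_eq_IIIstar`, `Literature/…/OggFormulaTypeIIIProofs`, bsd.S15 — the inputs of
`Additive/SelectorIdentityTameThreeHolds.lean`) ⟹ the valued-field lemma
`NonSplitAtThree.root_eq_root_of_shapeIII` (`O5/NonSplitAtThreeLocal.lean`) ⟹ root-uniqueness moves
down the change of variables (`Ψ₃'(u⁻²(y − r)) = u⁻⁸Ψ₃(y)`) and along the `ℚ`-algebra isomorphism
`ℚ_[3] ≃ₐ[ℚ] ℚ_{(3)}` (Mathlib `Padic.adicCompletionEquiv`, `Polynomial.aeval_algHom_apply`) to
Mathlib's `ℚ_[3]`, where `numStableLinesAtThree` counts the roots; (t′) ⟺ III / III*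
(`subTprime_three_iff_kodairaSymbolAt_III_or_IIIstar`, `Additive/KodairaDictionaryThree.lean`).
EFFECT: the `(hns : NonSplitAtThreeLaw)` binders of `O5/O5KummerLine.lean`
(`O5.kummerTorsorsAgree_of_cases`) and `O5/O5LocalShapeProofs.lean` (`kummerTorsorsAgree_of_cases'`)
are fed by name with `nonSplitAtThreeLaw_holds`; the G3-1′ "theorem-candidate" tag is the typer's to
restamp (doc-only).
WORDING (EVIDENCE framing): the censuses 61/61 + 10/10 (kit j129977) and 129/129 (o5-r1 GEN 4) "`ψ₃` has
0 or 1 root in `ℚ₃`, never more" stay EVIDENCE; nothing is booked; O5 stays OPEN; no mark moves.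
NOT here: which of 0 / 1 occurs (that is the selector identity `SelectorIdentityTameThree`, already a
theorem, `Additive/SelectorIdentityTameThreeHolds.lean`); the wild cell; anything at `p ≠ 3`.

References: J. H. Silverman, *Advanced Topics in the Arithmetic of Elliptic Curves*, GTM 151 (1994),
IV.9.4 Steps 4, 9, Table 4.1 [SilvermanATAEC1994]; J.-P. Serre, Invent. Math. 15 (1972) §1.11
Prop. 10 [Serre1972]; cell files `cells/o5o6/TARGETS.md` §O5 (o5-r1 GEN 3/4, G3-1′),
`b2b-bsdres-harvest-2/gen37/E83-L-O5-G3-1-locators.md` §4 (c).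
-/

noncomputable section

open scoped Classical

open Polynomial WeierstrassCurve IsDedekindDomain IsDedekindDomain.HeightOneSpectrum WithZero
  Rat.HeightOneSpectrum Literature.NumberTheory.EllipticCurves
  Summit.BirchSwinnertonDyer.Rank1Residual.Additive

namespace Summit.BirchSwinnertonDyer.Rank1Residual.O5

namespace NonSplitAtThree


/-! ## §3 Curves over the completion `K_v` (`3` a uniformiser): the III and III* b-shapes -/

section Completion

variable {A : Type*} [CommRing A] [IsDedekindDomain A] {K : Type*} [Field K] [Algebra A K]
  [IsFractionRing A K] (v : HeightOneSpectrum A)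

/-- Units of `𝒪_v` have valuation `1` in `K_v`. [folklore] -/
theorem valued_coe_eq_one_of_isUnit {β : v.adicCompletionIntegers K} (hβ : IsUnit β) :
    Valued.v (β : v.adicCompletion K) = 1 := by
  have hint : ∀ γ : v.adicCompletionIntegers K, Valued.v (γ : v.adicCompletion K) ≤ 1 := fun γ ↦ γ.2
  obtain ⟨γ, hγ⟩ := hβ.exists_right_inv
  have h1 : Valued.v (β : v.adicCompletion K) * Valued.v (γ : v.adicCompletion K) = 1 := by
    rw [← map_mul, ← Subring.coe_mul, hγ]; simp
  refine le_antisymm (hint β) ?_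
  calc (1 : ℤᵐ⁰) = Valued.v (β : v.adicCompletion K) * Valued.v (γ : v.adicCompletion K) := h1.symm
    _ ≤ Valued.v (β : v.adicCompletion K) * 1 := mul_le_mul' le_rfl (hint γ)
    _ = _ := mul_one _

/-- **Type III: `Ψ₃` has at most one root in `K_v`.** On a `K_v`-model with `b₂ = πβ₂`, `b₄ = πβ₄`,
`b₆ = π²β₆`, `Δ = π³δ` (`βᵢ ∈ 𝒪_v`, `δ ∈ 𝒪_v^×`; Silverman *ATAEC* IV.9.4 Step 4 normal form) and `π = 3`
in `K_v`, any two `K_v`-roots of `Ψ₃` coincide (§1).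
[cite: SilvermanATAEC1994, IV.9.4 Step 4 (normal form of type III)] -/
theorem Ψ₃_root_unique_of_shapeIII {π : K} (hπ : v.valuation K π = exp (-1 : ℤ))
    (h3 : (π : v.adicCompletion K) = 3) (N : WeierstrassCurve (v.adicCompletion K))
    (β₂ β₄ β₆ δ : v.adicCompletionIntegers K) (hδ : IsUnit δ)
    (hb₂ : N.b₂ = (π : v.adicCompletion K) ^ 1 * β₂)
    (hb₄ : N.b₄ = (π : v.adicCompletion K) ^ 1 * β₄)
    (hb₆ : N.b₆ = (π : v.adicCompletion K) ^ 2 * β₆)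
    (hΔ : N.Δ = (π : v.adicCompletion K) ^ 3 * δ) (x y : v.adicCompletion K)
    (hx : N.Ψ₃.eval x = 0) (hy : N.Ψ₃.eval y = 0) : x = y := by
  set w : Valuation (v.adicCompletion K) ℤᵐ⁰ := Valued.v with hw
  set ϖ : v.adicCompletion K := (π : v.adicCompletion K) with hϖ
  have hπv : w ϖ = exp (-1 : ℤ) := by rw [hw, hϖ, valuedAdicCompletion_eq_valuation', hπ]
  have hint : ∀ β : v.adicCompletionIntegers K, w (β : v.adicCompletion K) ≤ 1 := fun β ↦ β.2
  have hunit : ∀ {β : v.adicCompletionIntegers K}, IsUnit β → w (β : v.adicCompletion K) = 1 :=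
    fun hβ ↦ valued_coe_eq_one_of_isUnit v hβ
  have h3' : (3 : v.adicCompletion K) = ϖ := h3.symm
  have wb₂ : w N.b₂ ≤ exp (-1 : ℤ) := by
    rw [hb₂, pow_one, map_mul, hπv]
    calc exp (-1 : ℤ) * w (β₂ : v.adicCompletion K) ≤ exp (-1 : ℤ) * 1 := mul_le_mul' le_rfl (hint β₂)
      _ = exp (-1 : ℤ) := mul_one _
  have wb₄ : w N.b₄ ≤ exp (-1 : ℤ) := by
    rw [hb₄, pow_one, map_mul, hπv]
    calc exp (-1 : ℤ) * w (β₄ : v.adicCompletion K) ≤ exp (-1 : ℤ) * 1 := mul_le_mul' le_rfl (hint β₄)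
      _ = exp (-1 : ℤ) := mul_one _
  have wb₆ : w N.b₆ ≤ exp (-2 : ℤ) := by
    rw [hb₆, map_mul, map_pow, hπv, ← exp_nsmul]
    calc exp (2 • (-1 : ℤ)) * w (β₆ : v.adicCompletion K) ≤ exp (2 • (-1 : ℤ)) * 1 :=
        mul_le_mul' le_rfl (hint β₆)
      _ = exp (-2 : ℤ) := by simp
  have wΔ : w (-N.b₂ ^ 2 * N.b₈ - 8 * N.b₄ ^ 3 - 27 * N.b₆ ^ 2 + 9 * N.b₂ * N.b₄ * N.b₆) =
      exp (-3 : ℤ) := by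
    rw [show -N.b₂ ^ 2 * N.b₈ - 8 * N.b₄ ^ 3 - 27 * N.b₆ ^ 2 + 9 * N.b₂ * N.b₄ * N.b₆ = N.Δ from rfl,
      hΔ, map_mul, map_pow, hπv, hunit hδ, mul_one, ← exp_nsmul]
    simp
  have wb₈ : w N.b₈ = exp (-2 : ℤ) :=
    NonSplitAtThree.map_b₈_of_shapeIII w h3' hπv wb₂ wb₄ wb₆ N.b_relation wΔ
  rw [WeierstrassCurve.eval_Ψ₃_eq] at hx hy
  exact NonSplitAtThree.root_eq_root_of_shapeIII w h3' hπv wb₂ wb₄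
    (wb₆.trans (by rw [exp_le_exp]; norm_num)) wb₈ hx hy

/-- **Type III*: `Ψ₃` has at most one root in `K_v`.** On a `K_v`-model with `b₂ = π²β₂`, `b₄ = π³β₄`,
`b₆ = π⁵β₆`, `Δ = π⁹δ` (Silverman *ATAEC* IV.9.4 Step 9 normal form) and `π = 3` in `K_v`: the weight
rescaling `bᵢ ↦ bᵢ/π^{i/2}`, `x ↦ x/π` lands on the type-III shape of §1 (`Ψ₃(x) = π⁴ · Ψ₃♭(x/π)`,
`Δ = π⁶ · Δ♭`), so any two `K_v`-roots coincide.
[cite: SilvermanATAEC1994, IV.9.4 Step 9 (normal form of type III*)] -/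
theorem Ψ₃_root_unique_of_shapeIIIstar {π : K} (hπ : v.valuation K π = exp (-1 : ℤ))
    (h3 : (π : v.adicCompletion K) = 3) (N : WeierstrassCurve (v.adicCompletion K))
    (β₂ β₄ β₆ δ : v.adicCompletionIntegers K) (hδ : IsUnit δ)
    (hb₂ : N.b₂ = (π : v.adicCompletion K) ^ 2 * β₂)
    (hb₄ : N.b₄ = (π : v.adicCompletion K) ^ 3 * β₄)
    (hb₆ : N.b₆ = (π : v.adicCompletion K) ^ 5 * β₆)
    (hΔ : N.Δ = (π : v.adicCompletion K) ^ 9 * δ) (x y : v.adicCompletion K)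
    (hx : N.Ψ₃.eval x = 0) (hy : N.Ψ₃.eval y = 0) : x = y := by
  set w : Valuation (v.adicCompletion K) ℤᵐ⁰ := Valued.v with hw
  set ϖ : v.adicCompletion K := (π : v.adicCompletion K) with hϖ
  have hπv : w ϖ = exp (-1 : ℤ) := by rw [hw, hϖ, valuedAdicCompletion_eq_valuation', hπ]
  have hϖ0 : ϖ ≠ 0 := by
    intro h0; rw [h0, map_zero] at hπv; exact exp_ne_zero hπv.symm
  have hint : ∀ β : v.adicCompletionIntegers K, w (β : v.adicCompletion K) ≤ 1 := fun β ↦ β.2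
  have hunit : ∀ {β : v.adicCompletionIntegers K}, IsUnit β → w (β : v.adicCompletion K) = 1 :=
    fun hβ ↦ valued_coe_eq_one_of_isUnit v hβ
  have h3' : (3 : v.adicCompletion K) = ϖ := h3.symm
  -- the rescaled invariants `b♭ᵢ = bᵢ / ϖ^{i/2}`
  set c₂ : v.adicCompletion K := N.b₂ / ϖ with hc₂
  set c₄ : v.adicCompletion K := N.b₄ / ϖ ^ 2 with hc₄
  set c₆ : v.adicCompletion K := N.b₆ / ϖ ^ 3 with hc₆
  set c₈ : v.adicCompletion K := N.b₈ / ϖ ^ 4 with hc₈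
  have ec₂ : c₂ = ϖ * β₂ := by rw [hc₂, hb₂]; field_simp
  have ec₄ : c₄ = ϖ * β₄ := by rw [hc₄, hb₄]; field_simp
  have ec₆ : c₆ = ϖ ^ 2 * β₆ := by rw [hc₆, hb₆]; field_simp
  have wc₂ : w c₂ ≤ exp (-1 : ℤ) := by
    rw [ec₂, map_mul, hπv]
    calc exp (-1 : ℤ) * w (β₂ : v.adicCompletion K) ≤ exp (-1 : ℤ) * 1 := mul_le_mul' le_rfl (hint β₂)
      _ = exp (-1 : ℤ) := mul_one _
  have wc₄ : w c₄ ≤ exp (-1 : ℤ) := by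
    rw [ec₄, map_mul, hπv]
    calc exp (-1 : ℤ) * w (β₄ : v.adicCompletion K) ≤ exp (-1 : ℤ) * 1 := mul_le_mul' le_rfl (hint β₄)
      _ = exp (-1 : ℤ) := mul_one _
  have wc₆ : w c₆ ≤ exp (-2 : ℤ) := by
    rw [ec₆, map_mul, map_pow, hπv, ← exp_nsmul]
    calc exp (2 • (-1 : ℤ)) * w (β₆ : v.adicCompletion K) ≤ exp (2 • (-1 : ℤ)) * 1 :=
        mul_le_mul' le_rfl (hint β₆)
      _ = exp (-2 : ℤ) := by simp
  have hrel : 4 * c₈ = c₂ * c₆ - c₄ ^ 2 := by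
    rw [hc₈, hc₂, hc₆, hc₄]
    field_simp
    linear_combination N.b_relation
  have hΔflat : -c₂ ^ 2 * c₈ - 8 * c₄ ^ 3 - 27 * c₆ ^ 2 + 9 * c₂ * c₄ * c₆ = N.Δ / ϖ ^ 6 := by
    rw [hc₈, hc₂, hc₆, hc₄, show N.Δ = -N.b₂ ^ 2 * N.b₈ - 8 * N.b₄ ^ 3 - 27 * N.b₆ ^ 2 +
      9 * N.b₂ * N.b₄ * N.b₆ from rfl]
    field_simp
  have wΔ : w (-c₂ ^ 2 * c₈ - 8 * c₄ ^ 3 - 27 * c₆ ^ 2 + 9 * c₂ * c₄ * c₆) = exp (-3 : ℤ) := by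
    rw [hΔflat, map_div₀, hΔ, map_mul, map_pow, map_pow, hπv, hunit hδ, mul_one, ← exp_nsmul,
      ← exp_nsmul, ← exp_sub]
    simp
  have wc₈ : w c₈ = exp (-2 : ℤ) :=
    NonSplitAtThree.map_b₈_of_shapeIII w h3' hπv wc₂ wc₄ wc₆ hrel wΔ
  -- the rescaled roots `x/ϖ`, `y/ϖ`
  have hresc : ∀ z : v.adicCompletion K, N.Ψ₃.eval z = 0 →
      3 * (z / ϖ) ^ 4 + c₂ * (z / ϖ) ^ 3 + 3 * c₄ * (z / ϖ) ^ 2 + 3 * c₆ * (z / ϖ) + c₈ = 0 := by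
    intro z hz
    rw [WeierstrassCurve.eval_Ψ₃_eq] at hz
    have h : 3 * (z / ϖ) ^ 4 + c₂ * (z / ϖ) ^ 3 + 3 * c₄ * (z / ϖ) ^ 2 + 3 * c₆ * (z / ϖ) + c₈ =
        (3 * z ^ 4 + N.b₂ * z ^ 3 + 3 * N.b₄ * z ^ 2 + 3 * N.b₆ * z + N.b₈) / ϖ ^ 4 := by
      rw [hc₈, hc₂, hc₆, hc₄]
      field_simp
    rw [h, hz, zero_div]
  have hxy := NonSplitAtThree.root_eq_root_of_shapeIII w h3' hπv wc₂ wc₄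
    (wc₆.trans (by rw [exp_le_exp]; norm_num)) wc₈ (hresc x hx) (hresc y hy)
  exact (div_left_inj' hϖ0).mp hxy

end Completion

end NonSplitAtThree

/-! ## §4 Curves over `ℚ`: Kodaira III / III* at `3` ⟹ at most one `G_{ℚ₃}`-stable line; the law -/

section Curves

open NonSplitAtThree

variable (W : WeierstrassCurve ℚ) [W.IsElliptic]

/-- **Kodaira III / III* at `3` ⟹ `Ψ₃` has at most one root in the completion `ℚ_{(3)}`** (Tate's
Step-4 / Step-9 normal forms over `K_v = ℚ_{(3)}`, bsd.S15, feed §3; root-uniqueness transfers down the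
change of variables, §2). [cite: SilvermanATAEC1994, IV.9.4 Steps 4 and 9, Table 4.1 (PDF pp. 344–346, 365)] -/
theorem Ψ₃_root_unique_adicCompletion_of_kodairaSymbolAt_III_or_IIIstar
    (hT : W.kodairaSymbolAt (placeOf 3) = .III ∨ W.kodairaSymbolAt (placeOf 3) = .IIIstar)
    (x y : (placeOf 3).adicCompletion ℚ)
    (hx : (W.baseChange ((placeOf 3).adicCompletion ℚ)).Ψ₃.eval x = 0)
    (hy : (W.baseChange ((placeOf 3).adicCompletion ℚ)).Ψ₃.eval y = 0) : x = y := by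
  haveI : PerfectField (IsLocalRing.ResidueField ((placeOf 3).adicCompletionIntegers ℚ)) :=
    PerfectField.ofFinite
  have h2 : ringChar (ℤ ⧸ (placeOf 3).asIdeal) ≠ 2 := by rw [ringChar_int_quot_placeOf 3]; decide
  have hgen : natGenerator (placeOf 3) = 3 :=
    Literature.NumberTheory.EllipticCurves.Rat.natGenerator_primesEquiv_symm ⟨3, Nat.prime_three⟩
  have hπ : (placeOf 3).valuation ℚ (3 : ℚ) = exp (-1 : ℤ) := by
    have h := valuation_natGenerator_int (placeOf 3)
    rwa [hgen, Nat.cast_ofNat] at h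
  have h3 : algebraMap ℚ ((placeOf 3).adicCompletion ℚ) 3 = 3 := map_ofNat _ 3
  rcases hT with hT | hT
  · obtain ⟨C, β₂, β₄, β₆, δ, hδ, hb₂, hb₄, hb₆, hΔ⟩ :=
      W.exists_variableChange_b_of_kodairaSymbolAt_eq_III (placeOf 3) h2 hT hπ
    exact Ψ₃_root_unique_of_variableChange _ C
      (Ψ₃_root_unique_of_shapeIII (placeOf 3) hπ h3 _ β₂ β₄ β₆ δ hδ hb₂ hb₄ hb₆ hΔ) x y hx hy
  · obtain ⟨C, β₂, β₄, β₆, δ, hδ, hb₂, hb₄, hb₆, hΔ⟩ :=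
      W.exists_variableChange_b_of_kodairaSymbolAt_eq_IIIstar (placeOf 3) h2 hT hπ
    exact Ψ₃_root_unique_of_variableChange _ C
      (Ψ₃_root_unique_of_shapeIIIstar (placeOf 3) hπ h3 _ β₂ β₄ β₆ δ hδ hb₂ hb₄ hb₆ hΔ) x y hx hy

/-- **Kodaira III / III* at `3` ⟹ `numStableLinesAtThree W ≤ 1`**: the `3`-division polynomial has at
most ONE root in `ℚ₃` (hence `W[3]` has at most one `G_{ℚ₃}`-stable line). Transport from `ℚ_{(3)}` to
Mathlib's `ℚ_[3]` along the `ℚ`-algebra isomorphism `Padic.adicCompletionEquiv`. No class hypothesis.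
[cite: SilvermanATAEC1994, IV.9.4 Steps 4 and 9 (normal forms of III, III*)] -/
theorem numStableLinesAtThree_le_one_of_kodairaSymbolAt_III_or_IIIstar [W.IsGloballyMinimal]
    (hT : W.kodairaSymbolAt (placeOf 3) = .III ∨ W.kodairaSymbolAt (placeOf 3) = .IIIstar) :
    numStableLinesAtThree W ≤ 1 := by
  unfold numStableLinesAtThree
  refine Finset.card_le_one.mpr fun a ha b hb ↦ ?_
  rw [Multiset.mem_toFinset, mem_roots', IsRoot.def, eval_map, ← aeval_def] at ha hb
  set Kv := (placeOf 3).adicCompletion ℚ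
  let e : ℚ_[3] ≃ₐ[ℚ] Kv := (Padic.adicCompletionEquiv ℤ ⟨3, Nat.prime_three⟩).toAlgEquiv
  have he : ∀ c : ℚ_[3], aeval c W.Ψ₃ = 0 → (W.baseChange Kv).Ψ₃.eval (e c) = 0 := by
    intro c hc
    rw [WeierstrassCurve.baseChange, map_Ψ₃, eval_map, ← aeval_def, aeval_algHom_apply, hc, map_zero]
  exact e.injective (Ψ₃_root_unique_adicCompletion_of_kodairaSymbolAt_III_or_IIIstar W hT
    (e a) (e b) (he a ha.2) (he b hb.2))

/-- **`NonSplitAtThreeLaw` IS A THEOREM** (cc-typer-5 / o5-r1's THEOREM-CANDIDATE G3-1′ of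
`O5/O5CompanionTransport.lean`, binders verbatim): for every elliptic, globally minimal `W/ℚ` with
`ClassO5 W 3` and `SubTprime W 3`, `numStableLinesAtThree W ≤ 1` — on O5b the local residual
representation `W[3]|G_{ℚ₃}` is NEVER split. `ClassO5` supplies `Addv W 3`; (t′) ⟺ Kodaira III / III*
(`subTprime_three_iff_kodairaSymbolAt_III_or_IIIstar`); the rest is
`numStableLinesAtThree_le_one_of_kodairaSymbolAt_III_or_IIIstar`. Feeds the `(hns : NonSplitAtThreeLaw)`
binders of `O5/O5KummerLine.lean` and `O5/O5LocalShapeProofs.lean` by name. Census 61/61 + 129/129 stays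
EVIDENCE; nothing booked; O5 OPEN; no mark. [folklore] -/
theorem nonSplitAtThreeLaw_holds : NonSplitAtThreeLaw := by
  intro W _ _ hO hT
  exact numStableLinesAtThree_le_one_of_kodairaSymbolAt_III_or_IIIstar W
    ((subTprime_three_iff_kodairaSymbolAt_III_or_IIIstar (W := W) hO.2.1).mp hT)

end Curves


end Summit.BirchSwinnertonDyer.Rank1Residual.O5

end
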